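import Literature.Combinatorics.LorentzianPolynomials.WordPolynomial
import Literature.Geometry.Kaehler.ComplexTorusMixedHodgeIndexRealPPClasses
import Literature.Geometry.Kaehler.ComplexTorusSemipositiveIntersection
import Literature.Geometry.Kaehler.ComplexTorusHodgeClassesEllipticProductKunneth
import Literature.Topology.FourManifolds.LatticeFormsOrthoSumSignature
import HarnessLib

/-!
# The volume polynomial `vol(w) = ((w_1 L_1 + ⋯ + w_n L_n)^g)` of positive line bundles on a complex torus is
# Lorentzian (Brändén–Huh 2020, Thm. 4.6, on a complex torus / abelian variety)

Layer `Literature/Geometry/Kaehler`, namespace `Literature.Geometry.Kaehler.ComplexTorus`; lane `lit-hodgefound` (Track 2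
foundations library, Layer A), seat p16, generation 27 (row g27-#3). Sequel of
`Literature/Combinatorics/LorentzianPolynomials/WordPolynomial.lean` (row g27-#2: `wordPolynomial d F = Σ_u F(u) w_u` and
**`wordPolynomial_mem_lorentzian`** — a symmetric positive function of words whose `2`-slices have at most one positive
eigenvalue gives a polynomial in `L^d_n`), of `…/LorentzianPolynomials/Basic.lean` (row g27-#1: `lorentzian σ d = L^d_n`,
Brändén–Huh's Def. 2.6; Prop. 4.4 `normCoeff_sq_ge`), and, on the torus side, of `ComplexTorusMixedHodgeIndexRealPPClasses`
(g26-#2: **`sigPos_sigNeg_restrict_realOneOneForms`**, the mixed Hodge index theorem on `H^{1,1}(X, ℝ)`: signature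
`(1, g² - 1)` of `Q_θ(α, β) = ∫_X ω_1 ∧ ⋯ ∧ ω_{g-2} ∧ α ∧ β` for every positive background), `ComplexTorusSemipositiveIntersection`
(p28: `wedgeFamily_sum_smul`, `torusIntegral_wedgeFamily_pos_of_pos`), `ComplexTorusHodgeClassesEllipticProductKunneth`
(`wedgeFamily_comp_perm`: mixed intersection numbers are symmetric) and `Topology/FourManifolds/LatticeFormsOrthoSumSignature`
(`sigPos_le_sigPos_of_comp`).

## Sources (verbatim)

* P. Brändén, J. Huh, *Lorentzian polynomials*, Ann. of Math. 192 (2020) [BrandenHuh2019] (held `paper:arxiv-1902.03719`),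
  §4.2 (p. 49): "Let `H = (H_1, …, H_n)` be a collection of […] divisors on `Y`. We define the *volume polynomial* of `H` by
  `vol_H(w) = (w_1 H_1 + ⋯ + w_n H_n)^d = Σ_{α ∈ Δ^d_n} (d!/α!) V_α(H) w^α`, where `V_α(H)` is the intersection product
  `V_α(H) = (H_1 ⋯ H_1 ⋯ H_n ⋯ H_n) = (1/d!) ∂^α vol_H`"; **Theorem 4.6.** "If `H_1, …, H_n` are nef divisors on `Y`, then
  `vol_H(w)` is a Lorentzian polynomial."; proof (pp. 49–50): "we may suppose that every divisor in `H` is very ample. In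
  this case, every coefficient of `vol_H` is positive. Thus, by Theorem 2.25, it is enough to show that `∂^α vol_H` is
  Lorentzian for every `α ∈ Δ^{d-2}_n`. Note that `(2!/d!) ∂^α vol_H(w) = (Σ_i w_i H_i · Σ_i w_i H_i · H_1 ⋯ H_n)`. […] the
  Hodge index theorem […] shows that the displayed quadratic form has exactly one positive eigenvalue."; §4.1 (p. 46):
  "`vol_K(w) = Σ_{1 ≤ i_1, …, i_d ≤ n} V(K_{i_1}, …, K_{i_d}) w_{i_1} ⋯ w_{i_d}`"; Prop. 4.4 (p. 47):
  "`c_α² ≥ c_{α+e_i-e_j} c_{α-e_i+e_j}`".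
* H. Lange, *Abelian Varieties over the Complex Numbers* (2023) [Lange2023AbelianVarietiesComplex], §2.2.1 p. 89:
  "`(L_1 · … · L_g) := ∫_X c₁(L_1) ∧ ⋯ ∧ c₁(L_g)`", Lemma 2.2.2 (a)(ii) (`(L^g) > 0` for positive `L`).
* T.-C. Dinh, V.-A. Nguyên, *The mixed Hodge–Riemann bilinear relations for compact Kähler manifolds*, GAFA 16 (2006)
  [DinhNguyen2006], Thm. 1.3 / §4 Prop. 4.1 (the mixed Hodge index theorem supplying "the displayed quadratic form has exactly
  one positive eigenvalue" for KÄHLER classes `ω_1, …, ω_{g-2}` on a compact Kähler manifold, here a complex torus — in the tree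
  as `sigPos_sigNeg_restrict_realOneOneForms`).

## Dictionary and statement

`X = E/Φ(ℤ^ι)` a complex torus of dimension `g` (`e : Fin (2g) ≃ ι` the oriented lattice frame, `∫_X = torusIntegral Φ e`);
`ω : σ → Alt²_ℝ(E; ℝ)` a finite family of POSITIVE real `(1,1)`-forms (`ω_i(iu, iv) = ω_i(u, v)`, `ω_i(iv, v) > 0` — e.g. the
Riemann forms `c₁`-data of polarizations `L_i`, `IsRiemannForm`), `c₁(L_i) = -ω_i` in the lane's normalisation. Brändén–Huh's
nef divisors `H_i` on a projective `Y` become the `L_i`; their `(w_1 H_1 + ⋯ + w_n H_n)^d` becomes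

  `vol(w) = Σ_{u ∈ σ^g} (L_{u_1} ⋯ L_{u_g}) w_{u_1} ⋯ w_{u_g}`,  `(L_{u_1} ⋯ L_{u_g}) = Re ∫_X c₁(L_{u_1}) ∧ ⋯ ∧ c₁(L_{u_g})`

(`volumePolynomial`, an `MvPolynomial σ ℝ`; `eval_volumePolynomial`: `vol(w) = Re ∫_X (Σ_i w_i c₁(L_i))^{∧g}`), and THEOREM 4.6
reads **`volumePolynomial Φ e ω ∈ lorentzian σ g`** (`volumePolynomial_mem_lorentzian`; `IsRiemannForm.volumePolynomial_mem_lorentzian`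
for polarizations of an abelian variety). The proof is Brändén–Huh's: the mixed numbers are symmetric (`2`-forms commute) and
positive (Lange Lemma 2.2.2 / the tree's `torusIntegral_wedgeFamily_pos_of_pos`), and the `2`-slice of the background word `τ`,
`(a, b) ↦ (L_{τ_1} ⋯ L_{τ_{g-2}} · L_a · L_b) = Q_{ω∘τ}(ω_a, ω_b)`, is the Gram matrix of the mixed Lefschetz form `Q_{ω∘τ}` on the
vectors `ω_a ∈ H^{1,1}(X, ℝ)`, whose positive index is at most that of `Q_{ω∘τ}|H^{1,1}(X, ℝ)`, which is `1` (mixed Hodge index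
theorem). KÄHLER VERSUS NEF: Brändén–Huh state Thm. 4.6 for nef divisors on a projective variety over any field (limits of
ample ones); what is proved here is the case of POSITIVE classes on a complex torus (not necessarily algebraic, not
necessarily rational classes), where the Hodge index input is the Kähler one.

## Contents (theorems + 2 definitions with bodies; no `sorry`, no named fact, net debt 0)

* §1 `mixedIntersectionNumber Φ e ω u = Re ∫_X c₁(L_{u_1}) ∧ ⋯ ∧ c₁(L_{u_g})`: real (`coe_mixedIntersectionNumber`), symmetric
  (`mixedIntersectionNumber_comp_perm`), positive for positive forms (`mixedIntersectionNumber_pos`).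
* §2 the `2`-slices: `wedgeFamily_append_two`, **`mixedIntersectionNumber_append_two`**
  (`(L_τ · L_a · L_b) = Q_{ω∘τ}(ω_a, ω_b)`), **`sigPos_slice_le_one`** (at most one positive eigenvalue).
* §3 `volumePolynomial`, **`eval_volumePolynomial`** (`vol(w) = Re ∫_X (Σ w_i c₁(L_i))^{∧g}`), `isHomogeneous_volumePolynomial`,
  **`volumePolynomial_mem_lorentzian`** (Thm. 4.6 on the torus), `IsRiemannForm.volumePolynomial_mem_lorentzian`, and the
  consequence **`mixedIntersectionNumber_sq_ge`** (Prop. 4.4 read back: the Alexandrov–Fenchel / Khovanskii–Teissier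
  inequalities `(L_τ L_a L_b)² ≥ (L_τ L_a L_a)(L_τ L_b L_b)` for all mixed backgrounds `τ`, from the Lorentzian property).

## References

* [BrandenHuh2019] P. Brändén, J. Huh, *Lorentzian polynomials*, Ann. of Math. (2) 192 (2020) 821–891, §4.2 Thm. 4.6 (p. 49)
  and its proof (pp. 49–50); §4.1 p. 46, Prop. 4.4 (p. 47).
* [Lange2023AbelianVarietiesComplex] H. Lange, *Abelian Varieties over the Complex Numbers* (2023), §2.2.1 p. 89, Lemma 2.2.2.
* [DinhNguyen2006] T.-C. Dinh, V.-A. Nguyên, GAFA 16 (2006), Thm. 1.3, §4 Prop. 4.1.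
-/

noncomputable section

-- Nested `Module ℝ ↥(realOneOneForms E)` / `FiniteDimensional` searches (cf. `ComplexTorusMixedHodgeIndexAllDegrees`).
set_option maxSynthPendingDepth 3

open scoped ComplexOrder
open Complex Module Finset
open Literature.Combinatorics.LorentzianPolynomials
open Literature.LinearAlgebra.Alternating

namespace Literature.Geometry.Kaehler

namespace ComplexTorus

universe u

variable {ι : Type*} [Fintype ι] [DecidableEq ι] {E : Type u} [NormedAddCommGroup E] [NormedSpace ℂ E]
  (Φ : (ι → ℝ) ≃L[ℝ] E) {g : ℕ} (e : Fin (2 * g) ≃ ι) {σ : Type*}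

/-! ## §1 The mixed intersection numbers `(L_{u_1} ⋯ L_{u_g})` of a word -/

section MixedNumbers

/-- **The mixed intersection number of a word** `u = (u_1, …, u_g)` in the line bundles `L_i` (forms `ω_i`, `c₁(L_i) = -ω_i`):
`(L_{u_1} ⋯ L_{u_g}) = Re ∫_X c₁(L_{u_1}) ∧ ⋯ ∧ c₁(L_{u_g})` ("`(L_1 · … · L_g) := ∫_X c₁(L_1) ∧ ⋯ ∧ c₁(L_g)`"; Brändén–Huh's
`(H_{i_1} ⋯ H_{i_d})`). [cite: Lange2023AbelianVarietiesComplex, §2.2.1 p. 89] [cite: BrandenHuh2019, §4.2 (p. 49, `V_α(H)`)] -/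
def mixedIntersectionNumber (ω : σ → E [⋀^Fin 2]→L[ℝ] ℝ) (u : Fin g → σ) : ℝ :=
  (torusIntegral Φ e (wedgeFamily g fun k ↦ ofRealForm (-(ω (u k))))).re

omit [Fintype ι] in
/-- `(L_{u_1} ⋯ L_{u_g})` unfolded. [cite: Lange2023AbelianVarietiesComplex, §2.2.1 p. 89] -/
theorem mixedIntersectionNumber_def (ω : σ → E [⋀^Fin 2]→L[ℝ] ℝ) (u : Fin g → σ) :
    mixedIntersectionNumber Φ e ω u = (torusIntegral Φ e (wedgeFamily g fun k ↦ ofRealForm (-(ω (u k))))).re := rfl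

omit [Fintype ι] in
/-- The integrand `c₁(L_{u_1}) ∧ ⋯ ∧ c₁(L_{u_g})` is a real form, so the integral is real:
`((L_{u_1} ⋯ L_{u_g}) : ℂ) = ∫_X c₁(L_{u_1}) ∧ ⋯ ∧ c₁(L_{u_g})`. [cite: Lange2023AbelianVarietiesComplex, §2.2.1 p. 89 ("`∈ ℤ`" for
line bundles; real for real classes)] -/
theorem coe_mixedIntersectionNumber (ω : σ → E [⋀^Fin 2]→L[ℝ] ℝ) (u : Fin g → σ) :
    (mixedIntersectionNumber Φ e ω u : ℂ) = torusIntegral Φ e (wedgeFamily g fun k ↦ ofRealForm (-(ω (u k)))) := by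
  rw [mixedIntersectionNumber]
  refine Complex.conj_eq_iff_re.1 ?_
  rw [← torusIntegral_conjForm, conjForm_wedgeFamily_of_real (conjForm_ofRealForm_neg_family fun k ↦ ω (u k))]

omit [Fintype ι] in
/-- **The mixed intersection numbers are symmetric** in the `L_{u_k}` ("the intersection product is symmetric and multilinear";
`2`-forms commute). [cite: BrandenHuh2019, §4.2 (p. 48, "the product `(D_1 ⋯ D_d)` is symmetric")]
[cite: Lange2023AbelianVarietiesComplex, §2.2.1 p. 89] -/
theorem mixedIntersectionNumber_comp_perm (ω : σ → E [⋀^Fin 2]→L[ℝ] ℝ) (p : Equiv.Perm (Fin g)) (u : Fin g → σ) :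
    mixedIntersectionNumber Φ e ω (u ∘ p) = mixedIntersectionNumber Φ e ω u := by
  rw [mixedIntersectionNumber, mixedIntersectionNumber,
    show (fun k ↦ ofRealForm (-(ω ((u ∘ p) k)))) = (fun k ↦ ofRealForm (E := E) (-(ω (u k)))) ∘ p from rfl,
    wedgeFamily_comp_perm]

/-- **Positivity: `(L_{u_1} ⋯ L_{u_g}) > 0` for positive forms `ω_i`** (Lange's Lemma 2.2.2 (a)(ii) in the mixed form of the
tree's `torusIntegral_wedgeFamily_pos_of_pos`; Brändén–Huh: "every coefficient of `vol_H` is positive").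
[cite: Lange2023AbelianVarietiesComplex, §2.2.1 Lemma 2.2.2 (a)(ii)] [cite: BrandenHuh2019, §4.2 proof of Thm. 4.6 (p. 49)] -/
theorem mixedIntersectionNumber_pos {ω : σ → E [⋀^Fin 2]→L[ℝ] ℝ} (h11 : ∀ i (u v : E), ω i ![I • u, I • v] = ω i ![u, v])
    (hpos : ∀ i (v : E), v ≠ 0 → 0 < ω i ![I • v, v]) (u : Fin g → σ) : 0 < mixedIntersectionNumber Φ e ω u := by
  have h := torusIntegral_wedgeFamily_pos_of_pos Φ e (fun k ↦ ω (u k)) (fun k ↦ h11 (u k)) (fun k ↦ hpos (u k))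
  rw [mixedIntersectionNumber]
  exact (Complex.lt_def.1 h).1

/-- `(L_{u_1} ⋯ L_{u_g}) > 0` for polarizations `L_i` (`IsRiemannForm`). [cite: Lange2023AbelianVarietiesComplex, §2.2.1 Lemma 2.2.2 (a)(ii)] -/
theorem IsRiemannForm.mixedIntersectionNumber_pos {ω : σ → E [⋀^Fin 2]→L[ℝ] ℝ} (hω : ∀ i, IsRiemannForm Φ (ω i))
    (u : Fin g → σ) : 0 < mixedIntersectionNumber Φ e ω u :=
  ComplexTorus.mixedIntersectionNumber_pos Φ e (fun i ↦ (hω i).1) (fun i ↦ (hω i).2.2) u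

end MixedNumbers

/-! ## §2 The `2`-slices `(a, b) ↦ (L_{τ_1} ⋯ L_{τ_m} · L_a · L_b) = Q_{ω∘τ}(ω_a, ω_b)` and their signature -/

section Slices

omit [Fintype ι] [DecidableEq ι] in
/-- `(τ, a, b)_{last} = b`, `(τ, a, b)_{m} = a`, `(τ, a, b)_k = τ_k`: the letters of the word `Fin.append τ ![a, b]`.
[cite: BrandenHuh2019, §4.1 (p. 46)] -/
theorem append_two_apply {m : ℕ} (τ : Fin m → σ) (a b : σ) :
    Fin.append τ ![a, b] (Fin.last (m + 1)) = b ∧ Fin.append τ ![a, b] (Fin.castSucc (Fin.last m)) = a ∧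
      ∀ k : Fin m, Fin.append τ ![a, b] (Fin.castSucc (Fin.castSucc k)) = τ k := by
  refine ⟨?_, ?_, fun k ↦ ?_⟩
  · rw [show (Fin.last (m + 1) : Fin (m + 2)) = Fin.natAdd m (1 : Fin 2) from Fin.ext (by simp), Fin.append_right]
    rfl
  · rw [show (Fin.castSucc (Fin.last m) : Fin (m + 2)) = Fin.natAdd m (0 : Fin 2) from Fin.ext (by simp),
      Fin.append_right]
    rfl
  · rw [show (Fin.castSucc (Fin.castSucc k) : Fin (m + 2)) = Fin.castAdd 2 k from Fin.ext (by simp), Fin.append_left]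

omit [Fintype ι] [DecidableEq ι] in
/-- **`c₁(L_{τ_1}) ∧ ⋯ ∧ c₁(L_{τ_m}) ∧ c₁(L_a) ∧ c₁(L_b)` as an iterated wedge**: the monomial of the word `(τ, a, b)` is
`((ω_τ-monomial) ∧ x_a) ∧ x_b`. [cite: Lange2023AbelianVarietiesComplex, §7.3.1 (the monomials of `D•`)] -/
theorem wedgeFamily_append_two {m : ℕ} (x : σ → E [⋀^Fin 2]→L[ℝ] ℂ) (τ : Fin m → σ) (a b : σ) :
    wedgeFamily (m + 2) (fun k ↦ x (Fin.append τ ![a, b] k)) =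
      ((wedgeFamily m fun k ↦ x (τ k)).wedge (x a)).wedge (x b) := by
  obtain ⟨hb, ha, hτ⟩ := append_two_apply τ a b
  rw [wedgeFamily_succ, wedgeFamily_succ]
  have h3 : Fin.init (Fin.init fun k ↦ x (Fin.append τ ![a, b] k)) = fun k ↦ x (τ k) := by
    funext k; simp only [Fin.init, hτ]
  rw [h3]
  simp only [Fin.init, hb, ha]

omit [Fintype ι] in
/-- **The `2`-slice of the mixed numbers is the mixed Lefschetz form on the classes:
`(L_{τ_1} ⋯ L_{τ_m} · L_a · L_b) = Q_{ω∘τ}(ω_a, ω_b)`**, `Q_θ(α, β) = Re ∫_X (-θ_1)_ℂ ∧ ⋯ ∧ (-θ_m)_ℂ ∧ α_ℂ ∧ β_ℂ` the tree's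
`mixedLefschetzRealForm` (`c₁(L_a) ∧ c₁(L_b) = (-ω_a) ∧ (-ω_b) = ω_a ∧ ω_b`; re-bracketing in the ring of graded forms).
Brändén–Huh: "`(2!/d!) ∂^α vol_H(w) = (Σ_i w_i H_i · Σ_i w_i H_i · H_1 ⋯ H_n)`". [cite: BrandenHuh2019, §4.2 proof of Thm. 4.6
(pp. 49–50)] [cite: Lange2023AbelianVarietiesComplex, §2.2.1 p. 89] -/
theorem mixedIntersectionNumber_append_two {m : ℕ} (e : Fin (2 * (m + 2)) ≃ ι) (ω : σ → E [⋀^Fin 2]→L[ℝ] ℝ)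
    (τ : Fin m → σ) (a b : σ) :
    mixedIntersectionNumber Φ e ω (Fin.append τ ![a, b]) =
      mixedLefschetzRealForm Φ e (fun k ↦ ω (τ k)) (show 2 + m = m + 2 by omega) (ω a) (ω b) := by
  have hQ : mixedLefschetzRealForm Φ e (fun k ↦ ω (τ k)) (show 2 + m = m + 2 by omega) (ω a) (ω b) =
      mixedLefschetzRealForm Φ e (fun k ↦ ω (τ k)) (show 2 + m = m + 2 by omega) (-(ω a)) (-(ω b)) := by
    rw [map_neg, map_neg, LinearMap.neg_apply, neg_neg]
  rw [hQ, mixedIntersectionNumber, mixedLefschetzRealForm_apply,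
    wedgeFamily_append_two (fun i ↦ ofRealForm (-(ω i))) τ a b]
  -- re-bracket `((W ∧ A) ∧ B) = W ∧ (A ∧ B)` in the ring of graded forms
  have hform : ((wedgeFamily m fun k ↦ ofRealForm (-(ω (τ k)))).wedge (ofRealForm (-(ω a)))).wedge
        (ofRealForm (-(ω b))) =
      ((wedgeFamily m fun j ↦ ofRealForm (-(ω (τ j)))).wedge
        ((ofRealForm (-(ω a))).wedge (ofRealForm (-(ω b))))).domDomCongr
          (finCongr (show 2 * m + (2 + 2) = 2 * (m + 2) by ring)) := by
    refine GForm.of_injective (2 * m + 2 + 2) ?_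
    rw [← GForm.of_mul_of, ← GForm.of_mul_of]
    change _ = GForm.of (2 * (m + 2)) _
    rw [GForm.of_domDomCongr_finCongr, ← GForm.of_mul_of, ← GForm.of_mul_of, mul_assoc]
  rw [hform]

variable [Fintype σ] [DecidableEq σ]

/-- **The `2`-slices have at most one positive eigenvalue** ("the Hodge index theorem […] shows that the displayed quadratic
form has exactly one positive eigenvalue"): for positive `ω_i` and any background word `τ ∈ σ^m`, the quadratic form
`v ↦ Σ_{a,b} v_a v_b (L_τ · L_a · L_b) = Q_{ω∘τ}(Σ v_a ω_a, Σ v_b ω_b)` on `ℝ^σ` is the pull-back of `Q_{ω∘τ}|H^{1,1}(X, ℝ)`, of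
signature `(1, g² - 1)` (mixed Hodge index theorem, tree `sigPos_sigNeg_restrict_realOneOneForms`), along
`v ↦ Σ v_a ω_a`, so `sigPos ≤ 1`. [cite: BrandenHuh2019, §4.2 proof of Thm. 4.6 (p. 50)] [cite: DinhNguyen2006, §1 Thm. 1.3
and §4 Prop. 4.1] -/
theorem sigPos_slice_le_one {m : ℕ} (e : Fin (2 * (m + 2)) ≃ ι) {ω : σ → E [⋀^Fin 2]→L[ℝ] ℝ}
    (h11 : ∀ i (u v : E), ω i ![I • u, I • v] = ω i ![u, v]) (hpos : ∀ i (v : E), v ≠ 0 → 0 < ω i ![I • v, v])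
    (τ : Fin m → σ) :
    sigPos (Matrix.toBilin' (Matrix.of fun a b : σ ↦
      mixedIntersectionNumber Φ e ω (Fin.append τ ![a, b]))).toQuadraticMap ≤ 1 := by
  haveI := finiteDimensional_complex Φ
  haveI := finiteDimensional_realForms Φ e (k := 2) (by omega)
  have hkr : 2 + m = m + 2 := by omega
  have hθ : (fun k ↦ ω (τ k)) ∈ positiveTuples E m := fun k ↦ ⟨h11 (τ k), hpos (τ k)⟩
  have hindex := (sigPos_sigNeg_restrict_realOneOneForms Φ e hkr hθ).1
  -- the linear map `v ↦ Σ v_a ω_a` into `H^{1,1}(X, ℝ)`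
  have hmem : ∀ v : σ → ℝ, Fintype.linearCombination ℝ ω v ∈ realOneOneForms E := fun v ↦ by
    rw [Fintype.linearCombination_apply]
    exact Submodule.sum_mem _ fun a _ ↦ Submodule.smul_mem _ _ (mem_realOneOneForms_of_I_smul (h11 a))
  have hLv : ∀ v : σ → ℝ, ((LinearMap.codRestrict _ (Fintype.linearCombination ℝ ω) hmem v : ↥(realOneOneForms E)) :
      E [⋀^Fin 2]→L[ℝ] ℝ) = ∑ a, v a • ω a := fun v ↦ by
    rw [LinearMap.codRestrict_apply, Fintype.linearCombination_apply]
  have hcomp : ∀ v w : σ → ℝ,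
      ((mixedLefschetzRealForm Φ e (fun k ↦ ω (τ k)) hkr).restrict (realOneOneForms E))
        (LinearMap.codRestrict _ (Fintype.linearCombination ℝ ω) hmem v)
        (LinearMap.codRestrict _ (Fintype.linearCombination ℝ ω) hmem w) =
      Matrix.toBilin' (Matrix.of fun a b : σ ↦ mixedIntersectionNumber Φ e ω (Fin.append τ ![a, b])) v w := by
    intro v w
    rw [LinearMap.BilinForm.restrict_apply, LinearMap.domRestrict_apply, hLv, hLv, Matrix.toBilin'_apply]
    simp only [map_sum, map_smul, LinearMap.sum_apply, LinearMap.smul_apply, smul_eq_mul, Finset.mul_sum,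
      Matrix.of_apply]
    rw [Finset.sum_comm]
    refine Finset.sum_congr rfl fun a _ ↦ Finset.sum_congr rfl fun b _ ↦ ?_
    rw [mixedIntersectionNumber_append_two]
    ring
  have hle : sigPos (Matrix.toBilin' (Matrix.of fun a b : σ ↦
      mixedIntersectionNumber Φ e ω (Fin.append τ ![a, b]))).toQuadraticMap ≤
      sigPos ((mixedLefschetzRealForm Φ e (fun k ↦ ω (τ k)) hkr).restrict (realOneOneForms E)).toQuadraticMap :=
    LinearMap.BilinForm.sigPos_le_sigPos_of_comp _ _ (LinearMap.codRestrict _ (Fintype.linearCombination ℝ ω) hmem) hcomp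
  exact hle.trans hindex.le

end Slices

/-! ## §3 The volume polynomial and Theorem 4.6 -/

section Volume

variable [Fintype σ]

/-- **The volume polynomial of the line bundles `L_i`** (forms `ω_i`, `c₁(L_i) = -ω_i`) on the torus `X`, in the variables
`w_i`, `i ∈ σ`: `vol(w) = Σ_{u ∈ σ^g} (L_{u_1} ⋯ L_{u_g}) w_{u_1} ⋯ w_{u_g}` — Brändén–Huh's
"`vol_H(w) = (w_1 H_1 + ⋯ + w_n H_n)^d = Σ_{α ∈ Δ^d_n} (d!/α!) V_α(H) w^α`" expanded by multilinearity as in their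
"`vol_K(w) = Σ_{1 ≤ i_1, …, i_d ≤ n} V(K_{i_1}, …, K_{i_d}) w_{i_1} ⋯ w_{i_d}`" (`eval_volumePolynomial`:
`vol(w) = Re ∫_X (Σ_i w_i c₁(L_i))^{∧g}`). [cite: BrandenHuh2019, §4.2 (p. 49, `vol_H`) and §4.1 (p. 46)] -/
def volumePolynomial (ω : σ → E [⋀^Fin 2]→L[ℝ] ℝ) : MvPolynomial σ ℝ :=
  wordPolynomial g (mixedIntersectionNumber Φ e ω)

omit [Fintype ι] in
/-- `vol` unfolded. [cite: BrandenHuh2019, §4.2 (p. 49)] -/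
theorem volumePolynomial_def (ω : σ → E [⋀^Fin 2]→L[ℝ] ℝ) :
    volumePolynomial Φ e ω = wordPolynomial g (mixedIntersectionNumber Φ e ω) := rfl

omit [Fintype ι] [Fintype σ] in
/-- `∫_X` commutes with finite sums. [cite: Lange2023AbelianVarietiesComplex, §6.2.4 p. 310] -/
private theorem torusIntegral_finset_sum'' {N : ℕ} (e : Fin N ≃ ι) {κ : Type*} (s : Finset κ)
    (θ : κ → E [⋀^Fin N]→L[ℝ] ℂ) : torusIntegral Φ e (∑ k ∈ s, θ k) = ∑ k ∈ s, torusIntegral Φ e (θ k) := by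
  simp only [torusIntegral, ContinuousAlternatingMap.sum_apply, Finset.mul_sum]

omit [Fintype ι] in
/-- **`vol(w) = ((w_1 L_1 + ⋯ + w_n L_n)^g) = Re ∫_X (Σ_i w_i c₁(L_i))^{∧g}`** — the defining identity of the volume
polynomial, by the multilinearity of the intersection numbers (tree `wedgeFamily_sum_smul`).
[cite: BrandenHuh2019, §4.2 (p. 49, "`vol_H(w) = (w_1 H_1 + ⋯ + w_n H_n)^d`")] [cite: Lange2023AbelianVarietiesComplex, §2.2.1 p. 89] -/
theorem eval_volumePolynomial (ω : σ → E [⋀^Fin 2]→L[ℝ] ℝ) (w : σ → ℝ) :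
    MvPolynomial.eval w (volumePolynomial Φ e ω) =
      (torusIntegral Φ e (wedgePow (ofRealForm (-(∑ i, w i • ω i))) g)).re := by
  rw [volumePolynomial, eval_wordPolynomial]
  have hform : ofRealForm (-(∑ i, w i • ω i)) = ∑ i, (w i : ℂ) • ofRealForm (E := E) (-(ω i)) := by
    rw [← Finset.sum_neg_distrib, ← ofRealFormHom_apply, map_sum]
    refine Finset.sum_congr rfl fun i _ ↦ ?_
    rw [ofRealFormHom_apply, ofRealForm_neg, ofRealForm_smul, ofRealForm_neg, smul_neg]
  rw [wedgePow, hform, wedgeFamily_sum_smul g (fun _ i ↦ (w i : ℂ)) (fun _ i ↦ ofRealForm (-(ω i))),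
    torusIntegral_finset_sum'' Φ e, Complex.re_sum]
  refine Finset.sum_congr rfl fun u _ ↦ ?_
  rw [torusIntegral_smul, ← Complex.ofReal_prod, Complex.re_ofReal_mul, mixedIntersectionNumber, mul_comm]

omit [Fintype ι] in
/-- `vol` is homogeneous of degree `g = dim X`. [cite: BrandenHuh2019, §4.2 (p. 49)] -/
theorem isHomogeneous_volumePolynomial (ω : σ → E [⋀^Fin 2]→L[ℝ] ℝ) : (volumePolynomial Φ e ω).IsHomogeneous g :=
  isHomogeneous_wordPolynomial _

variable [DecidableEq σ]

omit [Fintype ι] in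
/-- The coefficients of `vol` are the fibre sums of the mixed numbers: `coeff_α vol = Σ_{content u = α} (L_{u_1} ⋯ L_{u_g})`
(`= (g!/α!) V_α` after symmetrisation). [cite: BrandenHuh2019, §4.2 (p. 49, "`Σ_α (d!/α!) V_α(H) w^α`")] -/
theorem coeff_volumePolynomial (ω : σ → E [⋀^Fin 2]→L[ℝ] ℝ) (α : σ →₀ ℕ) :
    MvPolynomial.coeff α (volumePolynomial Φ e ω) =
      ∑ u : Fin g → σ, if content u = α then mixedIntersectionNumber Φ e ω u else 0 :=
  coeff_wordPolynomial _ α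

/-- "every coefficient of `vol_H` is positive" (on `Δ^g`), for positive forms. [cite: BrandenHuh2019, §4.2 proof of Thm. 4.6 (p. 49)] -/
theorem coeff_volumePolynomial_pos {ω : σ → E [⋀^Fin 2]→L[ℝ] ℝ} (h11 : ∀ i (u v : E), ω i ![I • u, I • v] = ω i ![u, v])
    (hpos : ∀ i (v : E), v ≠ 0 → 0 < ω i ![I • v, v]) (u : Fin g → σ) :
    0 < MvPolynomial.coeff (content u) (volumePolynomial Φ e ω) :=
  (coeff_wordPolynomial_pos_iff (mixedIntersectionNumber_pos Φ e h11 hpos)).2 ⟨u, rfl⟩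

/-- **THEOREM 4.6 (Brändén–Huh) on a complex torus: the volume polynomial of positive line bundles is Lorentzian** —
`vol(w) = ((w_1 L_1 + ⋯ + w_n L_n)^g) ∈ L^g_n` for POSITIVE real `(1,1)`-forms `ω_i` (`c₁(L_i) = -ω_i`) on `X = E/Φ(ℤ^ι)` of
dimension `g`. Proof as printed: the coefficients (mixed intersection numbers) are positive, and each `(g-2)`-fold derivative
"`(2!/d!) ∂^α vol(w) = (Σ_i w_i L_i · Σ_i w_i L_i · L^α)`" is a quadratic form with exactly one positive eigenvalue by the
Hodge index theorem — here the mixed Hodge index theorem on `H^{1,1}(X, ℝ)` of the tree (Dinh–Nguyên / Timorin for Kähler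
classes), assembled by `wordPolynomial_mem_lorentzian` (the common skeleton of Thms. 4.1 / 4.6) — in `L^g_n` as DEFINED by
Brändén–Huh's Def. 2.6 (= Lorentzian by their Thm. 2.25). Brändén–Huh's setting is nef divisors on a projective variety over
an algebraically closed field; this is the positive-`(1,1)`-class case on a complex torus. [cite: BrandenHuh2019, §4.2 Thm. 4.6
(p. 49) and its proof (pp. 49–50)] [cite: DinhNguyen2006, §1 Thm. 1.3 and §4 Prop. 4.1]
[cite: Lange2023AbelianVarietiesComplex, §2.2.1 Lemma 2.2.2 (a)(ii)] -/
theorem volumePolynomial_mem_lorentzian : ∀ {g : ℕ} (e : Fin (2 * g) ≃ ι) {ω : σ → E [⋀^Fin 2]→L[ℝ] ℝ},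
    (∀ i (u v : E), ω i ![I • u, I • v] = ω i ![u, v]) → (∀ i (v : E), v ≠ 0 → 0 < ω i ![I • v, v]) →
    volumePolynomial Φ e ω ∈ lorentzian σ g
  | 0, e, _, h11, hpos => wordPolynomial_mem_lorentzian_zero fun u ↦ (mixedIntersectionNumber_pos Φ e h11 hpos u).le
  | 1, e, _, h11, hpos => wordPolynomial_mem_lorentzian_one fun u ↦ (mixedIntersectionNumber_pos Φ e h11 hpos u).le
  | m + 2, e, ω, h11, hpos =>
    wordPolynomial_mem_lorentzian m (mixedIntersectionNumber Φ e ω)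
      (fun p u ↦ mixedIntersectionNumber_comp_perm Φ e ω p u) (mixedIntersectionNumber_pos Φ e h11 hpos)
      (sigPos_slice_le_one Φ e h11 hpos)

/-- **The volume polynomial of polarizations `L_1, …, L_n` of an abelian variety is Lorentzian** (`ω_i` Riemann forms).
[cite: BrandenHuh2019, §4.2 Thm. 4.6 (p. 49)] [cite: Lange2023AbelianVarietiesComplex, §2.2.1 Lemma 2.2.2 (a)(ii)] -/
theorem IsRiemannForm.volumePolynomial_mem_lorentzian {ω : σ → E [⋀^Fin 2]→L[ℝ] ℝ} (hω : ∀ i, IsRiemannForm Φ (ω i)) :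
    volumePolynomial Φ e ω ∈ lorentzian σ g :=
  ComplexTorus.volumePolynomial_mem_lorentzian Φ e (fun i ↦ (hω i).1) (fun i ↦ (hω i).2.2)

/-- **Prop. 4.4 read back on the torus — the Alexandrov–Fenchel / Khovanskii–Teissier inequalities in every mixed background:**
`(L_τ · L_a · L_a)(L_τ · L_b · L_b) ≤ (L_τ · L_a · L_b)²` for positive `ω_i`, any word `τ ∈ σ^m` (`g = m + 2`) and any `a, b`
(`c_α² ≥ c_{α+e_a-e_b} c_{α-e_a+e_b}` for `α = content(τ, a, b)`, the normalized coefficients of `vol` being `g! ·` the mixed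
numbers; obtained here directly from the slice signature by the backwards Schwarz inequality). [cite: BrandenHuh2019, §4.1
Prop. 4.4 (p. 47) and the Alexandrov–Fenchel inequality quoted before it] [cite: DinhNguyen2006, §1 Cor. 1.2] -/
theorem mixedIntersectionNumber_sq_ge {m : ℕ} (e : Fin (2 * (m + 2)) ≃ ι) {ω : σ → E [⋀^Fin 2]→L[ℝ] ℝ}
    (h11 : ∀ i (u v : E), ω i ![I • u, I • v] = ω i ![u, v]) (hpos : ∀ i (v : E), v ≠ 0 → 0 < ω i ![I • v, v])
    (τ : Fin m → σ) (a b : σ) :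
    mixedIntersectionNumber Φ e ω (Fin.append τ ![a, a]) * mixedIntersectionNumber Φ e ω (Fin.append τ ![b, b]) ≤
      mixedIntersectionNumber Φ e ω (Fin.append τ ![a, b]) ^ 2 := by
  set M : Matrix σ σ ℝ := Matrix.of fun a b : σ ↦ mixedIntersectionNumber Φ e ω (Fin.append τ ![a, b]) with hM
  have hsymm : M.IsSymm := Matrix.IsSymm.ext fun a b ↦ by
    rw [hM, Matrix.of_apply, Matrix.of_apply, mixedIntersectionNumber_append_two, mixedIntersectionNumber_append_two]
    exact (isSymm_mixedLefschetzRealForm Φ e _ _ even_two).eq _ _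
  have hB : LinearMap.IsSymm (Matrix.toBilin' M) := ⟨fun v w ↦ by
    rw [Matrix.toBilin'_apply', Matrix.toBilin'_apply', Matrix.dotProduct_mulVec, ← Matrix.mulVec_transpose, hsymm.eq,
      dotProduct_comm, RingHom.id_apply]⟩
  have key := Literature.LinearAlgebra.QuadraticForm.mul_le_sq_of_sigPos_le_one (Matrix.toBilin' M) hB
    (sigPos_slice_le_one Φ e h11 hpos τ) (Pi.single a 1) (Pi.single b 1)
    (by rw [Matrix.toBilin'_single]; exact (mixedIntersectionNumber_pos Φ e h11 hpos _).le)
  simpa only [Matrix.toBilin'_single, hM, Matrix.of_apply] using key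

end Volume

end ComplexTorus

end Literature.Geometry.Kaehler

end
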